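import Summits.MatrixMultiplication.OmegaCensus.STPPSmallPatternKernelSearch

/-!
# ω-census, small STPP pattern `(2,1,1)^k`: the T-FIRST kernel engine (definitions only)

HONEST FRAMING (pub-omega census; verbatim): lottery ticket; floor = certified bounds/negative ranges.
Census STRUCTURE bookkeeping of the STPP track (seat pub-omega-stpp-1, gen 38; STRUCTURE row B5, the threshold column
`T1(H) = max {k : (2,1,1)^k ⊆ H}` — its LOWER sides «`H` hosts no `(2,1,1)^k` family» as kernel theorems), not progress on
`ω`: small patterns in small groups bound no exponent.

A second, group-independent search ENGINE for «`ℤ/n` admits no STPP family of size pattern `(2,1,1)^K`» (CKSU 2005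
Def. 5.1, tree `IsSTPP`), searching the same DIFFERENCE MODEL `ModelD p q c` as `STPPSmallPatternKernelSearch.lean`
(`Aᵢ = {pᵢ, qᵢ}`, `Bᵢ = {0}`, `Cᵢ = {cᵢ}`), but in the opposite order — the `c`-SET FIRST:

* T-PHASE (`tsearch`): an orderly depth-first enumeration of the `K`-subsets `T = {c₀ < ⋯}` of codes containing `0`,
  pruning a prefix `P` as soon as some affine map `x ↦ u (x − a)` (`a ∈ P`, `u` a listed unit) carries `P` to a set that is
  smaller in the COLEX order (the least element of the symmetric difference lies in the image: `canonBad`).  The reflection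
  file shows that the colex-minimal member of the affine orbit of any `c`-set survives every level (prefix lemma), so no
  orbit table is needed.
* S-PHASE (`tleaf`, `psearch`): for a surviving `T`, a forward-checked PLACEMENT search.  A placement `(j, a)` means
  `a ∈ A_j`; two placements `(j, a) ≠ (l, b)` are compatible iff `b − a ∉ E_{jl} := D_j ∪ (−D_l) ∪ {0}`,
  `D_j = (T − c_j) ∖ {0}` (this is `ModelD` read pairwise).  The state is ONE natural number `M` holding a 64-bit SALT
  (bits `< 64`, see `psalt`) and, for every class `l < K`, a LANE of width `W = 2n` (bits `[64 + lW, 64 + (l+1)W)`) whose low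
  `n` bits are the codes still allowed for class `l` and whose bit `n` is a SENTINEL (always set); `S1` / `S2` are the
  sentinel bits of the classes still owing one / two elements.  Placing `(j, a)`
  clears, in every lane `l`, the translate `a + E_{jl}` — ONE lane-wise rotation of the doubled pattern
  `EP_j = Σ_l (E_{jl} + E_{jl}·2^n)·2^{lW}` (`((EP_j · 2^a) >>> n) &&& lown`, three kernel-accelerated `ℕ` operations;
  lanes and codes are handled as isolated bits throughout — `Nat.log2` is not kernel-accelerated) — and,
  for the first element of a pair, the codes `≤ a` of lane `j` (pairs are oriented by code).  The translation symmetry of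
  the `A`'s is spent on `p₀ = 0` with `q₀ ≤ n − q₀` (class `0` is the class of `c = 0`).  A node is REFUTED when some
  open lane has fewer allowed codes than it owes (a sentinel borrow trick flags candidate lanes, the flagged lane is
  re-checked exactly — only the exact check is used by the reflection), otherwise the engine branches over all allowed
  codes of one open lane (lanes owing one element with one code left first, then lanes with two codes left, else the
  first open lane; classes are pre-ordered by `|E_{0l}|`).  `true` = every branch refuted.
* CHUNKS: `tsearchRoots c roots` runs the T-phase below each listed prefix; `frontierOK c J roots` re-runs the T-phase to
  depth `J` and checks that every surviving prefix is listed.  All recursions are recursor applications and every mask is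
  evaluated once (`force`), as in the first engine.

Soundness is `STPP211TFirstReflect*.lean`; nothing in this file is trusted.  Desk record (C mirrors `tfirst.c`,
`kmirror.c`, node counts for all abelian groups of order 30–37 at `K = 7`): pub-omega HOME `pub-omega-stpp-1-g38/`.

References: H. Cohn, R. Kleinberg, B. Szegedy, C. Umans, *Group-theoretic algorithms for matrix multiplication*, FOCS 2005
(arXiv:math/0511460), Def. 5.1.
-/

namespace Summit.MatrixMultiplication.OmegaCensus

namespace STPP211T

open STPP211Neg (force lowBit allBits lowMask rot)

/-! ## 1. Context: the constants of `(n, K)` as literals -/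

/-- The constants of a run (all evaluated once by `withTC`): group order `n`, number of classes `K`, lane width
`W = 2n`, total pattern width `KW = K·W`, `fulln = 2^n − 1`; the STATE layout puts a 64-bit SALT in bits `[0, 64)` (see
`children`) and lane `l < K` in bits `[64 + lW, 64 + (l+1)W)`: `lown` = all content bits (`fulln` at `64 + lW`), `sent` = all
sentinel bits (`64 + lW + n`), `ones` = bit `64 + lW` of every lane, `call = lown ||| sent ||| (2^64 − 1)`, `cut0` = `call` with
the lane-`0` codes outside `[1, n/2]` cleared; `allKW = 2^{KW} − 1` and `upK = K·(n + 64)` address the kill patterns; the unit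
list of the T-phase; the fuel `2K + 1` of the S-phase. -/
structure TC where
  /-- group order -/ n : ℕ
  /-- number of classes (triples) -/ K : ℕ
  /-- lane width `2n` -/ W : ℕ
  /-- `K * W` -/ KW : ℕ
  /-- `2^n − 1` -/ fulln : ℕ
  /-- content bits of all lanes -/ lown : ℕ
  /-- sentinel bits of all lanes -/ sent : ℕ
  /-- bit `0` of every lane -/ ones : ℕ
  /-- `lown ||| sent` -/ call : ℕ
  /-- `2^{KW} − 1` -/ allKW : ℕ
  /-- `call` with the lane-`0` codes outside `[1, n/2]` cleared -/ cut0 : ℕ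
  /-- `K · (n + 64)`: shift of the kill patterns (`EPup`) -/ upK : ℕ
  /-- units of `ℤ/n` used for pruning -/ units : List ℕ
  /-- fuel of the placement search (`2K + 1`) -/ fuel : ℕ

/-- `Σ_{l < K} v · 2^{lW}` (recursor form). -/
noncomputable def repLanes (K W v : ℕ) : ℕ :=
  @Nat.rec (fun _ => ℕ) 0 (fun l acc => force acc fun acc' => Nat.lor acc' (Nat.shiftLeft v (Nat.mul l W))) K

/-- The context of `(n, K, units)` as a term (the reflection's reference value). -/
noncomputable def mkTC (n K : ℕ) (units : List ℕ) : TC :=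
  ⟨n, K, 2 * n, K * (2 * n), lowMask n,
    Nat.shiftLeft (repLanes K (2 * n) (lowMask n)) 64,
    Nat.shiftLeft (repLanes K (2 * n) (Nat.shiftLeft 1 n)) 64,
    Nat.shiftLeft (repLanes K (2 * n) 1) 64,
    Nat.lor (Nat.lor (Nat.shiftLeft (repLanes K (2 * n) (lowMask n)) 64)
      (Nat.shiftLeft (repLanes K (2 * n) (Nat.shiftLeft 1 n)) 64)) (lowMask 64),
    lowMask (K * (2 * n)),
    Nat.xor (Nat.lor (Nat.lor (Nat.shiftLeft (repLanes K (2 * n) (lowMask n)) 64)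
      (Nat.shiftLeft (repLanes K (2 * n) (Nat.shiftLeft 1 n)) 64)) (lowMask 64))
      (Nat.shiftLeft (Nat.xor (lowMask n) (Nat.xor (lowMask (Nat.add (Nat.div n 2) 1)) 1)) 64),
    K * (n + 64), units, 2 * K + 1⟩

/-- Evaluate every constant of the context to a literal ONCE, then run `body` on the literal context. -/
noncomputable def withTC {α : Type} (n K : ℕ) (units : List ℕ) (body : TC → α) : α :=
  force (Nat.mul 2 n) fun W => force (Nat.mul K W) fun KW => force (lowMask n) fun fulln =>
  force (Nat.shiftLeft (repLanes K W fulln) 64) fun lown =>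
  force (Nat.shiftLeft (repLanes K W (Nat.shiftLeft 1 n)) 64) fun sent =>
  force (Nat.shiftLeft (repLanes K W 1) 64) fun ones =>
  force (Nat.lor (Nat.lor lown sent) (lowMask 64)) fun call => force (lowMask KW) fun allKW =>
  force (Nat.xor call (Nat.shiftLeft (Nat.xor fulln (Nat.xor (lowMask (Nat.add (Nat.div n 2) 1)) 1)) 64)) fun cut0 =>
  force (Nat.mul K (Nat.add n 64)) fun upK =>
  force (Nat.add (Nat.mul 2 K) 1) fun fuel =>
  body ⟨n, K, W, KW, fulln, lown, sent, ones, call, allKW, cut0, upK, units, fuel⟩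

/-! ## 2. Small recursor-form helpers -/

/-- Disjunction of `f` over a list. -/
noncomputable def anyL (L : List ℕ) (f : ℕ → Bool) : Bool :=
  @List.rec ℕ (fun _ => Bool) false (fun hd _ ih => f hd || ih) L

/-- Head of a list of codes (`0` for `[]`). -/
noncomputable def headL (L : List ℕ) : ℕ :=
  @List.rec ℕ (fun _ => ℕ) 0 (fun hd _ _ => hd) L

/-- Length of a list of codes. -/
noncomputable def lengthL (L : List ℕ) : ℕ :=
  @List.rec ℕ (fun _ => ℕ) 0 (fun _ _ ih => Nat.add ih 1) L

/-- The mask `Σ_{t ∈ L} 2^t` of a list of codes. -/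
noncomputable def maskL (L : List ℕ) : ℕ :=
  @List.rec ℕ (fun _ => ℕ) 0 (fun t _ acc => Nat.lor acc (Nat.shiftLeft 1 t)) L

/-- Number of set bits of `x` (at most `fuel` of them are counted; called with `fuel ≥` the count). -/
noncomputable def popc (fuel x : ℕ) : ℕ :=
  @Nat.rec (fun _ => ℕ → ℕ) (fun _ => 0)
    (fun _ ih y => @Bool.rec (fun _ => ℕ) (force (Nat.land y (Nat.sub y 1)) fun y' => Nat.add (ih y') 1) 0 (Nat.beq y 0))
    fuel x

/-! ## 3. T-phase: colex-canonical prefixes -/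

/-- Mask of the image of the code list `L` under `x ↦ u · (x − a) mod n`. -/
noncomputable def imageMask (c : TC) (L : List ℕ) (a u : ℕ) : ℕ :=
  @List.rec ℕ (fun _ => ℕ) 0
    (fun t _ acc => Nat.lor acc (Nat.shiftLeft 1 (Nat.mod (Nat.mul u (Nat.mod (Nat.add t (Nat.sub c.n a)) c.n)) c.n))) L

/-- PRUNING TEST: some listed affine map `x ↦ u (x − a)` (`a ∈ L`, `u ∈ units`) carries the prefix (`L`, mask `PM`)
to a colex-smaller set: the image differs from `PM` and the least differing code lies in the image. -/
noncomputable def canonBad (c : TC) (L : List ℕ) (PM : ℕ) : Bool :=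
  anyL L fun a => anyL c.units fun u =>
    force (imageMask c L a u) fun I => force (Nat.xor I PM) fun d =>
      !(Nat.beq d 0) && !(Nat.beq (Nat.land I (lowBit d)) 0)

/-- ONE T-LEVEL below the prefix (`L` = codes so far, largest first; `PM` = its mask): every larger code `x < n` either
makes a pruned prefix or leads to a refuted subtree (`rec`). -/
noncomputable def tnode (c : TC) (rec : List ℕ → ℕ → Bool) (L : List ℕ) (PM : ℕ) : Bool :=
  force (Nat.land c.fulln (Nat.xor c.fulln (lowMask (Nat.add (headL L) 1)))) fun cand =>
  allBits cand (fun x0 => force x0 fun x => force (Nat.lor PM (Nat.shiftLeft 1 x)) fun PM' =>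
    canonBad c (x :: L) PM' || rec (x :: L) PM') cand

/-! ## 4. S-phase: the placement search on packed lanes (index-free: lanes are addressed by their sentinel bit) -/

/-- Conjunction of `body L` over the set bits of `F`, lowest first, each passed as its ISOLATED BIT `L = 2^a` (no `Nat.log2`:
it is not kernel-accelerated); at most `fuel` bits, called with `fuel = F`. -/
noncomputable def allLow (fuel : ℕ) (body : ℕ → Bool) : ℕ → Bool :=
  @Nat.rec (fun _ => ℕ → Bool) (fun _ => true)
    (fun _ ih F => @Bool.rec (fun _ => Bool)
      (force (lowBit F) fun L => body L && ih (Nat.xor F L)) true (Nat.beq F 0))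
    fuel

/-- The content (`n` bits) of the lane of `M` whose sentinel bit is `sb = 2^{64+lW+n}` (`M / 2^{64+lW}`, masked). -/
def laneVal (c : TC) (M sb : ℕ) : ℕ := Nat.land (Nat.div M (Nat.shiftRight sb c.n)) c.fulln

/-- BRANCHING HEURISTIC (no soundness content; the caller re-checks that the lane is open): a lane owing one element with
exactly one code left, else a lane owing two with exactly two left, else a lane owing one with two left, else the first
open lane — returned as a word whose lowest set bit is the lane's sentinel.  `t2`, `Y` are the borrow words of `pnode`. -/
noncomputable def chooseBit (c : TC) (t2 Y S1 S2 S : ℕ) : ℕ :=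
  force (Nat.xor S1 (Nat.land t2 S1)) fun E1 =>
  @Bool.rec (fun _ => ℕ) E1
    (force (Nat.sub (Nat.lor (Nat.land Y t2) c.sent) c.ones) fun t3 =>
     force (Nat.xor S (Nat.land t3 S)) fun E2 =>
     force (Nat.land E2 S2) fun E2b =>
     @Bool.rec (fun _ => ℕ) E2b
       (force (Nat.land E2 S1) fun E2a => @Bool.rec (fun _ => ℕ) E2a S (Nat.beq E2a 0))
       (Nat.beq E2b 0))
    (Nat.beq E1 0)

/-- SALT of a placement: a multiplicative hash in `[0, 2^64)` of the code bit `L` and the lane tag `tg`.  KERNEL FINDING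
(stpp-1 g36, `STPP211CosetEngine` v2, reproduced here): the kernel hashes a big literal by its low word only, so packed states
sharing their low lane collide in the `whnf` cache and a search turns quadratic (here: 2 065 nodes 2 s, 47 000 nodes > 1 700 s);
XOR-ing this hash into the low 64 bits of the state at every placement keeps the cache healthy.  The salt never influences a
decision (the reflection ignores bits `< 64`). -/
def psalt (L tg : ℕ) : ℕ :=
  Nat.mod (Nat.mul (Nat.add (Nat.add L tg) 1) 11400714819323198485) 18446744073709551616

/-- THE CHILDREN of a node along the lane with sentinel bit `sb` (doubled kill patterns `EPl` of that class, aligned with the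
state; lane tag `tg`): for every allowed code `a` of the lane (as its bit `L = 2^a`), clear `a + E_{l,l'}` in every lane `l'` —
the lane-wise rotation `((EPl · L) >>> n) &&& lown` of the doubled patterns — and refresh the salt; for the FIRST element of the
pair also clear the codes `≤ a` of the lane (mask `(2L − 1) · 2^{64+lW}`) and move its sentinel from `S2` to `S1` (the lane now
owes one); for the SECOND element remove its sentinel from `S1` (lane closed).  Both moves are `xor` with `sb`.  Conjunction of
`rec` over the children. -/
noncomputable def children (c : TC) (rec : ℕ → ℕ → ℕ → Bool) (M S1 S2 sb EPl tg : ℕ) : Bool :=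
  force (laneVal c M sb) fun V =>
  force (Nat.xor S1 sb) fun S1x => force (Nat.xor S2 sb) fun S2x => force (Nat.shiftRight sb c.n) fun base =>
  @Bool.rec (fun _ => Bool)
    (allLow V (fun L =>
      force (Nat.xor (Nat.land M (Nat.xor c.call (Nat.land (Nat.shiftRight (Nat.mul EPl L) c.n) c.lown))) (psalt L tg))
        fun M1 => rec M1 S1x S2) V)
    (allLow V (fun L =>
      force (Nat.xor (Nat.land (Nat.land M (Nat.xor c.call (Nat.land (Nat.shiftRight (Nat.mul EPl L) c.n) c.lown)))
          (Nat.xor c.call (Nat.mul (Nat.sub (Nat.add L L) 1) base))) (psalt L tg)) fun M2 =>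
      rec M2 S1x S2x) V)
    (!(Nat.beq (Nat.land S2 sb) 0))

/-- ONE NODE of the placement search (`EPup` = all doubled kill patterns shifted up by `upK = K(n + 64)`, so that the patterns
of the class with sentinel `sb` are `EPup / sb^K` masked to `KW` bits): refute if some lane owing one element has no code left
or some lane owing two has at most one (flagged by the sentinel borrow words `t1`, `t2`, confirmed exactly on the flagged lane —
only the exact test matters to the reflection); a node owing nothing is a complete family (`false`); otherwise branch
(`children`) on the lane proposed by `chooseBit`, after checking that its sentinel is open. -/
noncomputable def pnode (c : TC) (EPup : ℕ) (rec : ℕ → ℕ → ℕ → Bool) (M S1 S2 : ℕ) : Bool :=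
  force (Nat.sub M c.ones) fun t1 =>
  force (Nat.land t1 S1) fun A0 =>
  (!(Nat.beq A0 S1) && Nat.beq (laneVal c M (lowBit (Nat.xor S1 A0))) 0) ||
  force (Nat.lor (Nat.land M t1) c.sent) fun Y =>
  force (Nat.sub Y c.ones) fun t2 =>
  force (Nat.land t2 S2) fun B0 =>
  (!(Nat.beq B0 S2) &&
    force (laneVal c M (lowBit (Nat.xor S2 B0))) fun v => Nat.beq (Nat.land v (Nat.sub v 1)) 0) ||
  force (Nat.lor S1 S2) fun S =>
  (!(Nat.beq S 0) &&
    force (lowBit (chooseBit c t2 Y S1 S2 S)) fun sb =>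
    (!(Nat.beq sb 0) && Nat.beq (Nat.land S sb) sb) &&
    force (Nat.shiftLeft (Nat.land (Nat.div EPup (Nat.pow sb c.K)) c.allKW) 64) fun EPl =>
    force (Nat.mod sb 2305843009213693951) fun tg =>
    children c rec M S1 S2 sb EPl tg)

/-- THE PLACEMENT SEARCH (fuel = nodes still allowed on a branch; `2K + 1` suffices). -/
noncomputable def psearch (c : TC) (EPup : ℕ) : ℕ → ℕ → ℕ → ℕ → Bool :=
  @Nat.rec (fun _ => ℕ → ℕ → ℕ → Bool) (fun _ _ _ => false) (fun _ ih M S1 S2 => pnode c EPup ih M S1 S2)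

/-! ## 5. The leaf: class order, kill patterns, the first placement -/

/-- Mask of `{−t : t ∈ L}` (codes `(n − t) mod n`). -/
noncomputable def negMask (c : TC) (L : List ℕ) : ℕ :=
  @List.rec ℕ (fun _ => ℕ) 0 (fun t _ acc => Nat.lor acc (Nat.shiftLeft 1 (Nat.mod (Nat.sub c.n t) c.n))) L

/-- `D(t) = (T − t) ∖ {0}` as a mask: rotate `PM` by `−t`, clear bit `0`. -/
noncomputable def dMask (c : TC) (PM t : ℕ) : ℕ := Nat.xor (rot c.n c.fulln PM (Nat.mod (Nat.sub c.n t) c.n)) 1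

/-- `−D(t) = (t − T) ∖ {0}` as a mask: rotate the negated mask `NM` by `t`, clear bit `0`. -/
noncomputable def ndMask (c : TC) (NM t : ℕ) : ℕ := Nat.xor (rot c.n c.fulln NM t) 1

/-- One selection round of the class order: among the codes `t ∈ L` still in `R`, the one with the largest key
`|D(0) ∪ −D(t) ∪ {0}|`, packed as `key · 256 + t` (ties: the smaller code — the list is descending and the fold sees its tail first). -/
noncomputable def bestCode (c : TC) (L : List ℕ) (D0 NM R : ℕ) : ℕ :=
  @List.rec ℕ (fun _ => ℕ) 0
    (fun t _ best => force best fun b =>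
      @Bool.rec (fun _ => ℕ) b
        (force (popc c.n (Nat.lor (Nat.lor D0 (ndMask c NM t)) 1)) fun key =>
          @Bool.rec (fun _ => ℕ) b (Nat.add (Nat.mul key 256) t) (Nat.blt (Nat.div b 256) key))
        (Nat.beq (Nat.land (Nat.shiftRight R t) 1) 1)) L

/-- CLASS ORDER as a packed code list `Σ_j code_j · 2^{8j}`: code `0` first (slot `0`), then, into slots `1, 2, …`,
repeatedly the best remaining code (the recursor index `j` counts down, hence slot `K − 1 − j`).  Heuristic only
(re-checked by `orderOK`). -/
noncomputable def orderCodes (c : TC) (L : List ℕ) (PM NM : ℕ) : ℕ :=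
  force (Nat.xor PM 1) fun D0 =>
  @Nat.rec (fun _ => ℕ → ℕ → ℕ) (fun _ acc => acc)
    (fun j ih R acc =>
      force (Nat.mod (bestCode c L D0 NM R) 256) fun t =>
      force (Nat.xor R (Nat.shiftLeft 1 t)) fun R' =>
      force (Nat.lor acc (Nat.shiftLeft t (Nat.mul 8 (Nat.sub (Nat.sub c.K 1) j)))) fun acc' => ih R' acc')
    (Nat.sub c.K 1) (Nat.xor PM 1) 0

/-- The `j`-th code of a packed code list. -/
def codeAt (OC j : ℕ) : ℕ := Nat.land (Nat.shiftRight OC (Nat.mul 8 j)) 255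

/-- All pairs of the first `K` listed codes are distinct (quadratic re-check). -/
noncomputable def codesDistinct (K OC : ℕ) : Bool :=
  @Nat.rec (fun _ => Bool) true
    (fun j acc => acc && @Nat.rec (fun _ => Bool) true
      (fun i acc2 => acc2 && (Nat.beq i j || !(Nat.beq (codeAt OC i) (codeAt OC j)))) K) K

/-- RE-CHECK of the class order: the `K` listed codes are pairwise distinct, their union is `PM`, and the first is `0`. -/
noncomputable def orderOK (c : TC) (PM OC : ℕ) : Bool :=
  Nat.beq (codeAt OC 0) 0 && codesDistinct c.K OC &&
  Nat.beq (@Nat.rec (fun _ => ℕ) 0 (fun j acc => force acc fun acc' => Nat.lor acc' (Nat.shiftLeft 1 (codeAt OC j))) c.K) PM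

/-- The doubled kill patterns of the class with code `t`: `Σ_l dbl(D(t) ∪ −D(code_l) ∪ {0}) · 2^{lW}`,
`dbl(E) = E ||| (E <<< n)`. -/
noncomputable def epOf (c : TC) (PM NM OC t : ℕ) : ℕ :=
  force (Nat.lor (dMask c PM t) 1) fun Dt =>
  @Nat.rec (fun _ => ℕ) 0
    (fun l acc => force acc fun acc' => force (Nat.lor Dt (ndMask c NM (codeAt OC l))) fun E =>
      Nat.lor acc' (Nat.shiftLeft (Nat.lor E (Nat.shiftLeft E c.n)) (Nat.mul l c.W))) c.K

/-- All kill patterns: class `j` at bits `[j·KW, (j+1)·KW)`. -/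
noncomputable def epAll (c : TC) (PM NM OC : ℕ) : ℕ :=
  @Nat.rec (fun _ => ℕ) 0
    (fun j acc => force acc fun acc' => force (epOf c PM NM OC (codeAt OC j)) fun EPj =>
      Nat.lor acc' (Nat.shiftLeft EPj (Nat.mul j c.KW))) c.K

/-- THE LEAF of the T-phase (`L` = the codes of `T`, `PM` = its mask): order the classes, build the kill patterns, make
the first placement `(0, 0)` (class `0` = the class of code `0`, through the same pattern reader as every later placement;
its second element restricted to `[1, n/2]`), salt the state and the pattern word with `PM`, and run the placement search.
`true` = refuted. -/
noncomputable def tleaf (c : TC) (L : List ℕ) (PM : ℕ) : Bool :=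
  force (negMask c L) fun NM =>
  force (orderCodes c L PM NM) fun OC =>
  orderOK c PM OC &&
  force (epAll c PM NM OC) fun EP =>
  force (Nat.lor (Nat.shiftLeft EP c.upK) PM) fun EPup =>
  force (Nat.pow 2 (Nat.add (Nat.add 64 (Nat.mul 0 (Nat.mul 2 c.n))) c.n)) fun sb0 =>
  force (Nat.shiftLeft (Nat.land (Nat.div EPup (Nat.pow sb0 c.K)) c.allKW) 64) fun EPl0 =>
  force (Nat.land (Nat.shiftRight (Nat.mul EPl0 (Nat.pow 2 0)) c.n) c.lown) fun K0 =>
  force (Nat.xor (Nat.land (Nat.land c.call (Nat.xor c.call K0)) c.cut0) PM) fun M =>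
  force (Nat.xor c.sent sb0) fun S2 =>
  psearch c EPup c.fuel M sb0 S2

/-! ## 6. The searches -/

/-- THE T-PHASE below a prefix, `r` codes still to add (`r = 0`: the leaf). -/
noncomputable def tsearch (c : TC) : ℕ → List ℕ → ℕ → Bool :=
  @Nat.rec (fun _ => List ℕ → ℕ → Bool) (fun L PM => tleaf c L PM) (fun _ ih L PM => tnode c ih L PM)

/-- The T-phase below ONE root prefix (a code list, largest first, containing `0`; depth and mask evaluated first). -/
noncomputable def rootSearch (c : TC) (L : List ℕ) : Bool :=
  force (Nat.sub c.K (lengthL L)) fun r => force (maskL L) fun PM => tsearch c r L PM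

/-- THE SEARCH over a list of root prefixes. -/
noncomputable def tsearchRoots (c : TC) (roots : List (List ℕ)) : Bool :=
  @List.rec (List ℕ) (fun _ => Bool) true
    (fun L _ ih => rootSearch c L && ih) roots

/-- `tsearchRoots` on a cons (used to split kernel evaluations). -/
theorem tsearchRoots_cons (c : TC) (L : List ℕ) (R : List (List ℕ)) :
    tsearchRoots c (L :: R) = (rootSearch c L && tsearchRoots c R) := rfl

/-- `tsearchRoots` is a conjunction over the root list. -/
theorem tsearchRoots_append (c : TC) (R₁ R₂ : List (List ℕ)) :
    tsearchRoots c (R₁ ++ R₂) = (tsearchRoots c R₁ && tsearchRoots c R₂) := by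
  induction R₁ with
  | nil => rfl
  | cons L R ih => rw [List.cons_append, tsearchRoots_cons, tsearchRoots_cons, ih, Bool.and_assoc]

/-- Equality of two code lists (recursor form, `Nat.beq` on the entries). -/
noncomputable def beqL (R L : List ℕ) : Bool :=
  @List.rec ℕ (fun _ => List ℕ → Bool) (fun L => @List.rec ℕ (fun _ => Bool) true (fun _ _ _ => false) L)
    (fun r _ ih L => @List.rec ℕ (fun _ => Bool) false (fun x L' _ => Nat.beq r x && ih L') L) R L

/-- FRONTIER CHECK: the T-phase from the prefix `[0]` down to depth `J` (that is, `J − 1` more codes), testing at depth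
`J` that the surviving prefix (as a code list, largest first) is one of the listed roots. -/
noncomputable def frontierOK (c : TC) (J : ℕ) (roots : List (List ℕ)) : Bool :=
  @Nat.rec (fun _ => List ℕ → ℕ → Bool)
    (fun L _ => @List.rec (List ℕ) (fun _ => Bool) false (fun R _ ih => beqL R L || ih) roots)
    (fun _ ih L PM => tnode c ih L PM) (Nat.sub J 1) [0] 1

/-- UNIT CHECK: every listed `u` is a unit of `ℤ/n` (`gcd(u, n) = 1`) and `2 ≤ n`. -/
noncomputable def unitsOK (n : ℕ) (units : List ℕ) : Bool :=
  Nat.ble 2 n && @List.rec ℕ (fun _ => Bool) true (fun u _ ih => Nat.beq (Nat.gcd u n) 1 && ih) units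

/-- THE KERNEL STATEMENT of a chunk: the searches below the listed roots, on the literal context. -/
noncomputable def runRoots (n K : ℕ) (units : List ℕ) (roots : List (List ℕ)) : Bool :=
  withTC n K units fun c => tsearchRoots c roots

/-- THE KERNEL STATEMENT of the frontier: on the literal context. -/
noncomputable def runFrontier (n K : ℕ) (units : List ℕ) (J : ℕ) (roots : List (List ℕ)) : Bool :=
  withTC n K units fun c => frontierOK c J roots

end STPP211T

end Summit.MatrixMultiplication.OmegaCensus
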